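import Mathlib
import Summits.MatrixMultiplication.MatrixMultiplication.Theorems.SoloBlindOlsonElement
import Summits.MatrixMultiplication.MatrixMultiplication.Theorems.SoloBlindOlsonBerman

set_option linter.dupNamespace false

/-!
# Solo-blind seat (MatrixMultiplication), s76 — maximum zero-sum-free sequences over `𝔽₃^r` miss a
hyperplane (HOME `paper/KraftK3.md` §7.18, K3.18.4; CLAIMS c806).  Part 3 of the Olson–Berman files
(parts 1–2: `SoloBlindOlsonElement`, `SoloBlindOlsonBerman`).

THEOREM (`soloBlindOH_misses_hyperplane`).  If `a₁,…,a_{2r} ∈ 𝔽₃^r` has no non-empty zero-sum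
subcollection, then some linear functional is non-zero on every `a_k`: `∃ y, ∀ k, Σ_i a_k i · y i ≠ 0`.

PROOF.  `𝔽₃[𝔽₃^r]` is the truncated polynomial ring in the `Yᵢ = 1 - [eᵢ]` (`Yᵢ³ = 0`).  Under
`Φ : Xᵢ ↦ Yᵢ` the polynomial `p_k = 1 - Π_i (1 - Xᵢ)^{a_k i}` goes to `1 - [a_k]`; `p_k` has no constant
term and linear part `ℓ_k = Σ_i (a_k i) Xᵢ`, so `P = Π_k p_k` and `L = Π_k ℓ_k` differ by terms of
degree `≥ 2r+1` and have the same coefficient at the top monomial `X₁²⋯X_r²`; that coefficient of `P`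
is the coefficient of `Φ(P) = Π_k (1 - [a_k])` at the group element `(2,…,2)` (`soloBlindOH_coeff_Phi`),
which is a signed representation count and equals `1` by the Olson–Berman congruence of part 2
(`soloBlindOB_signedCount_eq_one`).  Hence `L`, homogeneous of degree `2r`, carries the monomial
`Π Xᵢ²` (`soloBlindOH_coeff_top_linear`, the graded form of Olson's theorem) and by Alon's Combinatorial
Nullstellensatz (`MvPolynomial.combinatorial_nullstellensatz_exists_eval_nonzero`; grid `𝔽₃^r`,
exponents `2 < 3`) it does not vanish identically on `𝔽₃^r`.
No `sorry`, standard axioms.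
-/

namespace Summit.MatrixMultiplication.MatrixMultiplication.Theorems

open Finset MvPolynomial

section OlsonHyperplane

variable {r : ℕ}

/-- `[eᵢ]^v = [v eᵢ]`. -/
theorem soloBlindOH_T_single_pow (i : Fin r) (v : ℕ) :
    soloBlindOBT r (Pi.single i 1) ^ v = soloBlindOBT r (Pi.single i (v : ZMod 3)) := by
  induction v with
  | zero => rw [pow_zero, Nat.cast_zero, Pi.single_zero, soloBlindOB_T_zero]
  | succ n ih => rw [pow_succ, ih, ← soloBlindOB_T_add, ← Pi.single_add, Nat.cast_succ]

/-- Every power `Yᵢ ^ n` is supported on the line `{c eᵢ}`. -/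
theorem soloBlindOH_line (i : Fin r) (n : ℕ) :
    ∃ v : ZMod 3 → ZMod 3, soloBlindOBY i ^ n = ∑ c : ZMod 3, v c • soloBlindOBT r (Pi.single i c) := by
  classical
  induction n with
  | zero =>
    refine ⟨fun c => if c = 0 then 1 else 0, ?_⟩
    rw [pow_zero]
    simp only [ite_smul, one_smul, zero_smul, Finset.sum_ite_eq', Finset.mem_univ, if_true,
      Pi.single_zero, soloBlindOB_T_zero]
  | succ n ih =>
    obtain ⟨v, hv⟩ := ih
    refine ⟨fun c => v c - v (c - 1), ?_⟩
    have hY : soloBlindOBY i = 1 - soloBlindOBT r (Pi.single i 1) := rfl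
    rw [pow_succ, hv, hY, Finset.sum_mul]
    simp_rw [mul_sub, mul_one, smul_mul_assoc, ← soloBlindOB_T_add, ← Pi.single_add, sub_smul,
      Finset.sum_sub_distrib]
    congr 1
    exact (Fintype.sum_equiv (Equiv.subRight (1 : ZMod 3)) _ _ fun c => by simp).symm

/-- The coefficient of `Yᵢ ^ n` at `[2eᵢ]` is `[n = 2]`. -/
theorem soloBlindOH_coeff_Y_pow (i : Fin r) (n : ℕ) :
    (soloBlindOBY i ^ n).coeff (Multiplicative.ofAdd (Pi.single i (2 : ZMod 3)))
      = if n = 2 then 1 else 0 := by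
  classical
  have h12 : (Pi.single i (1 : ZMod 3) : Fin r → ZMod 3) ≠ Pi.single i 2 := fun h => by
    have := congrFun h i; simp at this; exact absurd this (by decide)
  have h02 : (0 : Fin r → ZMod 3) ≠ Pi.single i 2 := fun h => by
    have := congrFun h i; simp at this; exact absurd this (by decide)
  have hT1 : (1 : SoloBlindOBAlg r).coeff (Multiplicative.ofAdd (Pi.single i (2 : ZMod 3))) = 0 := by
    rw [← soloBlindOB_T_zero, soloBlindOB_T_apply, if_neg h02]
  rcases Nat.lt_or_ge n 3 with h | h
  · interval_cases n
    · rw [pow_zero, hT1]; simp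
    · rw [pow_one]
      unfold soloBlindOBY
      rw [MonoidAlgebra.coeff_sub, Finsupp.sub_apply, hT1, soloBlindOB_T_apply, if_neg h12]; simp
    · rw [soloBlindOB_Y_sq, MonoidAlgebra.coeff_add, Finsupp.add_apply, MonoidAlgebra.coeff_add,
        Finsupp.add_apply, hT1, soloBlindOB_T_apply, if_neg h12, sq, ← soloBlindOB_T_add,
        ← Pi.single_add, soloBlindOB_T_apply]
      norm_num
  · obtain ⟨k, rfl⟩ := Nat.exists_eq_add_of_le h
    rw [pow_add, soloBlindOB_Y_cube, zero_mul, MonoidAlgebra.coeff_zero, Finsupp.zero_apply, if_neg (by omega)]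

/-- The coefficient of a `Y`-monomial `Π Yᵢ^{αᵢ}` at the group element `(2,…,2)` is `[α = (2,…,2)]`. -/
theorem soloBlindOH_coeff_prod_Y_pow (α : Fin r → ℕ) :
    (∏ i, soloBlindOBY (r := r) i ^ α i).coeff (Multiplicative.ofAdd fun _ => (2 : ZMod 3))
      = if (∀ i, α i = 2) then 1 else 0 := by
  classical
  have hl := fun i : Fin r => soloBlindOH_line i (α i)
  choose v hv using hl
  have hv2 : ∀ i, v i 2 = if α i = 2 then 1 else 0 := by
    intro i
    rw [← soloBlindOH_coeff_Y_pow i (α i), hv i, MonoidAlgebra.coeff_sum, Finsupp.finsetSum_apply]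
    simp_rw [MonoidAlgebra.coeff_smul_apply, soloBlindOB_T_apply, smul_eq_mul, mul_ite, mul_one,
      mul_zero]
    simp [Pi.single_inj]
  simp_rw [hv]
  rw [Finset.prod_univ_sum]
  simp only [Fintype.piFinset_univ]
  simp_rw [Finset.prod_smul, ← soloBlindOB_T_sum, Finset.univ_sum_single]
  rw [MonoidAlgebra.coeff_sum, Finsupp.finsetSum_apply]
  simp_rw [MonoidAlgebra.coeff_smul_apply, soloBlindOB_T_apply, smul_eq_mul, mul_ite, mul_one,
    mul_zero]
  rw [Finset.sum_ite_eq' univ, if_pos (mem_univ _)]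
  simp_rw [hv2]
  convert Fintype.prod_boole (p := fun i => α i = 2) (M₀ := ZMod 3)

/-- `Φ : 𝔽₃[X₁,…,X_r] → 𝔽₃[𝔽₃^r]`, `Xᵢ ↦ Yᵢ = 1 - [eᵢ]`. -/
noncomputable def soloBlindOHPhi (r : ℕ) :
    MvPolynomial (Fin r) (ZMod 3) →ₐ[ZMod 3] SoloBlindOBAlg r :=
  MvPolynomial.aeval fun i => soloBlindOBY i

/-- The top monomial exponent `(2,…,2)`. -/
noncomputable def soloBlindOHTop (r : ℕ) : Fin r →₀ ℕ :=
  Finsupp.equivFunOnFinite.symm fun _ => 2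

/-- `Φ` of a monic monomial is the corresponding `Y`-monomial. -/
theorem soloBlindOH_Phi_monomial (α : Fin r →₀ ℕ) :
    soloBlindOHPhi r (monomial α 1) = ∏ i, soloBlindOBY i ^ α i := by
  unfold soloBlindOHPhi
  rw [aeval_monomial, map_one, one_mul, Finsupp.prod_fintype _ _ fun i => pow_zero _]

/-- The coefficient of `Φ Q` at the group element `(2,…,2)` is the top coefficient of `Q`. -/
theorem soloBlindOH_coeff_Phi (Q : MvPolynomial (Fin r) (ZMod 3)) :
    (soloBlindOHPhi r Q).coeff (Multiplicative.ofAdd fun _ => (2 : ZMod 3))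
      = Q.coeff (soloBlindOHTop r) := by
  classical
  conv_lhs => rw [Q.as_sum]
  rw [map_sum, MonoidAlgebra.coeff_sum, Finsupp.finsetSum_apply]
  have hmon : ∀ v : Fin r →₀ ℕ, monomial v (Q.coeff v) = C (Q.coeff v) * monomial v 1 := by
    intro v; rw [C_mul_monomial, mul_one]
  have hterm : ∀ v : Fin r →₀ ℕ,
      (soloBlindOHPhi r (monomial v (Q.coeff v))).coeff (Multiplicative.ofAdd fun _ => (2 : ZMod 3))
        = if v = soloBlindOHTop r then Q.coeff v else 0 := by
    intro v
    rw [hmon, map_mul, show soloBlindOHPhi r (C (Q.coeff v)) = algebraMap _ _ (Q.coeff v) from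
      aeval_C _ _, ← Algebra.smul_def, MonoidAlgebra.coeff_smul_apply, soloBlindOH_Phi_monomial,
      soloBlindOH_coeff_prod_Y_pow, smul_eq_mul, mul_ite, mul_one, mul_zero]
    congr 1
    simp only [soloBlindOHTop, Finsupp.ext_iff, Finsupp.coe_equivFunOnFinite_symm]
  simp_rw [hterm]
  rw [Finset.sum_ite_eq']
  by_cases h : soloBlindOHTop r ∈ Q.support
  · rw [if_pos h]
  · rw [if_neg h, (notMem_support_iff.mp h)]

/-- `Φ (1 - Π_i (1 - Xᵢ)^{vᵢ}) = 1 - [v]`. -/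
theorem soloBlindOH_Phi_p (v : Fin r → ZMod 3) :
    soloBlindOHPhi r (1 - ∏ i, (1 - X i) ^ (v i).val) = 1 - soloBlindOBT r v := by
  unfold soloBlindOHPhi
  rw [map_sub, map_one, map_prod]
  simp_rw [map_pow, map_sub, map_one, aeval_X]
  have hY : ∀ i : Fin r, 1 - soloBlindOBY i = soloBlindOBT r (Pi.single i 1) := fun i => by
    unfold soloBlindOBY; rw [sub_sub_cancel]
  simp_rw [hY, soloBlindOH_T_single_pow, ZMod.natCast_zmod_val]
  rw [← soloBlindOB_T_sum, Finset.univ_sum_single]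

/-- Low-order vanishing is additive in products: if `p` has no monomials of degree `< a` and `q` none of
degree `< b`, then `p q` has none of degree `< a + b`. -/
theorem soloBlindOH_low_mul {p q : MvPolynomial (Fin r) (ZMod 3)} {a b : ℕ}
    (hp : ∀ m : Fin r →₀ ℕ, m.degree < a → p.coeff m = 0)
    (hq : ∀ m : Fin r →₀ ℕ, m.degree < b → q.coeff m = 0) :
    ∀ m : Fin r →₀ ℕ, m.degree < a + b → (p * q).coeff m = 0 := by
  classical
  intro m hm
  rw [coeff_mul]
  refine Finset.sum_eq_zero fun x hx => ?_
  rw [Finset.HasAntidiagonal.mem_antidiagonal] at hx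
  have hdeg : x.1.degree + x.2.degree = m.degree := by rw [← map_add, hx]
  rcases lt_or_ge x.1.degree a with h1 | h1
  · rw [hp _ h1, zero_mul]
  · rw [hq _ (by omega), mul_zero]

/-- A product of `#s` factors without constant term has no monomials of degree `< #s`. -/
theorem soloBlindOH_low_prod {ι : Type*} (s : Finset ι) (l : ι → MvPolynomial (Fin r) (ZMod 3))
    (hl : ∀ i ∈ s, ∀ m : Fin r →₀ ℕ, m.degree < 1 → (l i).coeff m = 0) :
    ∀ m : Fin r →₀ ℕ, m.degree < s.card → (∏ i ∈ s, l i).coeff m = 0 := by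
  classical
  induction s using Finset.induction_on with
  | empty => intro m hm; simp at hm
  | insert j s hj ih =>
    rw [Finset.prod_insert hj, Finset.card_insert_of_notMem hj, add_comm]
    exact soloBlindOH_low_mul (hl j (mem_insert_self j s))
      (ih fun i hi => hl i (mem_insert_of_mem hi))

/-- `Π (1 + fᵢ) = 1 + Σ fᵢ + (degree ≥ 2)` when the `fᵢ` have no constant term. -/
theorem soloBlindOH_prod_one_add {ι : Type*} (s : Finset ι) (f : ι → MvPolynomial (Fin r) (ZMod 3))
    (hf : ∀ i ∈ s, ∀ m : Fin r →₀ ℕ, m.degree < 1 → (f i).coeff m = 0) :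
    ∃ R : MvPolynomial (Fin r) (ZMod 3), (∀ m : Fin r →₀ ℕ, m.degree < 2 → R.coeff m = 0) ∧
      ∏ i ∈ s, (1 + f i) = 1 + ∑ i ∈ s, f i + R := by
  classical
  induction s using Finset.induction_on with
  | empty => exact ⟨0, fun m _ => coeff_zero m, by simp⟩
  | insert j s hj ih =>
    obtain ⟨R, hR, hprod⟩ := ih fun i hi => hf i (mem_insert_of_mem hi)
    have hfj := hf j (mem_insert_self j s)
    have hsum : ∀ m : Fin r →₀ ℕ, m.degree < 1 → (∑ i ∈ s, f i).coeff m = 0 := by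
      intro m hm
      rw [coeff_sum]
      exact Finset.sum_eq_zero fun i hi => hf i (mem_insert_of_mem hi) m hm
    refine ⟨R + f j * ∑ i ∈ s, f i + f j * R, ?_, ?_⟩
    · intro m hm
      rw [coeff_add, coeff_add, hR m hm, soloBlindOH_low_mul hfj hsum m (by omega),
        soloBlindOH_low_mul hfj hR m (by omega)]
      simp
    · rw [Finset.prod_insert hj, Finset.sum_insert hj, hprod]
      ring

/-- `Π (lᵢ + hᵢ) = Π lᵢ + (degree ≥ #s + 1)` when the `lᵢ` have no constant term and the `hᵢ` no
monomials of degree `< 2`. -/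
theorem soloBlindOH_prod_add {ι : Type*} (s : Finset ι) (l h : ι → MvPolynomial (Fin r) (ZMod 3))
    (hl : ∀ i ∈ s, ∀ m : Fin r →₀ ℕ, m.degree < 1 → (l i).coeff m = 0)
    (hh : ∀ i ∈ s, ∀ m : Fin r →₀ ℕ, m.degree < 2 → (h i).coeff m = 0) :
    ∃ R : MvPolynomial (Fin r) (ZMod 3), (∀ m : Fin r →₀ ℕ, m.degree < s.card + 1 → R.coeff m = 0) ∧
      ∏ i ∈ s, (l i + h i) = ∏ i ∈ s, l i + R := by
  classical
  induction s using Finset.induction_on with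
  | empty => exact ⟨0, fun m _ => coeff_zero m, by simp⟩
  | insert j s hj ih =>
    obtain ⟨R, hR, hprod⟩ := ih (fun i hi => hl i (mem_insert_of_mem hi))
      (fun i hi => hh i (mem_insert_of_mem hi))
    have hlj := hl j (mem_insert_self j s)
    have hhj := hh j (mem_insert_self j s)
    have hL := soloBlindOH_low_prod s l fun i hi => hl i (mem_insert_of_mem hi)
    refine ⟨l j * R + h j * ∏ i ∈ s, l i + h j * R, ?_, ?_⟩
    · intro m hm
      rw [Finset.card_insert_of_notMem hj] at hm
      rw [coeff_add, coeff_add, soloBlindOH_low_mul hlj hR m (by omega),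
        soloBlindOH_low_mul hhj hL m (by omega), soloBlindOH_low_mul hhj hR m (by omega)]
      simp
    · rw [Finset.prod_insert hj, Finset.prod_insert hj, hprod]
      ring

/-- `(1 - Xᵢ)^{c} = 1 - c Xᵢ + (degree ≥ 2)` for `c ∈ 𝔽₃` (exponent `c.val ∈ {0,1,2}`). -/
theorem soloBlindOH_one_sub_X_pow (i : Fin r) (c : ZMod 3) :
    ∃ q : MvPolynomial (Fin r) (ZMod 3), (∀ m : Fin r →₀ ℕ, m.degree < 2 → q.coeff m = 0) ∧
      (1 - X i : MvPolynomial (Fin r) (ZMod 3)) ^ c.val = 1 + (-(C c * X i) + q) := by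
  classical
  fin_cases c
  · refine ⟨0, fun m _ => coeff_zero m, ?_⟩
    show (1 - X i : MvPolynomial (Fin r) (ZMod 3)) ^ 0 = 1 + (-(C 0 * X i) + 0)
    rw [pow_zero, map_zero]; ring
  · refine ⟨0, fun m _ => coeff_zero m, ?_⟩
    show (1 - X i : MvPolynomial (Fin r) (ZMod 3)) ^ 1 = 1 + (-(C 1 * X i) + 0)
    rw [pow_one, map_one]; ring
  · refine ⟨X i ^ 2, ?_, ?_⟩
    · intro m hm
      rw [coeff_X_pow, if_neg]
      rintro rfl
      rw [Finsupp.degree_single] at hm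
      omega
    · have h2 : (C 2 : MvPolynomial (Fin r) (ZMod 3)) = 2 := map_ofNat C 2
      show (1 - X i : MvPolynomial (Fin r) (ZMod 3)) ^ 2 = 1 + (-(C 2 * X i) + X i ^ 2)
      rw [h2]; ring

/-- `p_v = 1 - Π_i (1 - Xᵢ)^{vᵢ} = Σ_i vᵢ Xᵢ + (degree ≥ 2)`. -/
theorem soloBlindOH_p_expand (v : Fin r → ZMod 3) :
    ∃ h : MvPolynomial (Fin r) (ZMod 3), (∀ m : Fin r →₀ ℕ, m.degree < 2 → h.coeff m = 0) ∧
      1 - ∏ i, (1 - X i : MvPolynomial (Fin r) (ZMod 3)) ^ (v i).val = ∑ i, C (v i) * X i + h := by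
  classical
  have hq := fun i : Fin r => soloBlindOH_one_sub_X_pow i (v i)
  choose q hq hpow using hq
  have hf : ∀ i ∈ (univ : Finset (Fin r)), ∀ m : Fin r →₀ ℕ, m.degree < 1 →
      (-(C (v i) * X i) + q i).coeff m = 0 := by
    intro i _ m hm
    have hm0 : m = 0 := (Finsupp.degree_eq_zero_iff m).mp (by omega)
    subst hm0
    rw [coeff_add, coeff_neg, coeff_C_mul, coeff_zero_X, mul_zero, neg_zero, zero_add,
      hq i 0 (by simp)]
  obtain ⟨R, hR, hprod⟩ := soloBlindOH_prod_one_add univ (fun i => -(C (v i) * X i) + q i) hf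
  refine ⟨-(∑ i, q i) - R, ?_, ?_⟩
  · intro m hm
    rw [coeff_sub, coeff_neg, coeff_sum, hR m hm, Finset.sum_eq_zero fun i _ => hq i m hm]
    simp
  · simp_rw [hpow]
    rw [hprod, Finset.sum_add_distrib, Finset.sum_neg_distrib]
    ring

/-- THE GRADED OLSON IDENTITY (top coefficient).  For a zero-sum-free `a₁,…,a_{2r}` in `𝔽₃^r`, the
product of the linear forms `ℓ_k = Σ_i (a_k i) Xᵢ` has coefficient `1` at `X₁²⋯X_r²`. -/
theorem soloBlindOH_coeff_top_linear {m : ℕ} (hm : m = 2 * r) (a : Fin m → Fin r → ZMod 3)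
    (hz : ∀ T : Finset (Fin m), T.Nonempty → ∑ k ∈ T, a k ≠ 0) :
    (∏ k, ∑ i, C (a k i) * X i : MvPolynomial (Fin r) (ZMod 3)).coeff (soloBlindOHTop r) = 1 := by
  classical
  have hp := fun k : Fin m => soloBlindOH_p_expand (a k)
  choose h hh hp using hp
  have hl : ∀ k ∈ (univ : Finset (Fin m)), ∀ mo : Fin r →₀ ℕ, mo.degree < 1 →
      (∑ i, C (a k i) * X i : MvPolynomial (Fin r) (ZMod 3)).coeff mo = 0 := by
    intro k _ mo hmo
    have hm0 : mo = 0 := (Finsupp.degree_eq_zero_iff mo).mp (by omega)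
    subst hm0
    rw [coeff_sum]
    exact Finset.sum_eq_zero fun i _ => by rw [coeff_C_mul, coeff_zero_X, mul_zero]
  obtain ⟨R, hR, hprod⟩ := soloBlindOH_prod_add univ (fun k => ∑ i, C (a k i) * X i) h hl
    (fun k _ => hh k)
  -- the image of `P = Π p_k` under `Φ` is Olson's element, whose coefficients are the signed counts
  have hP : soloBlindOHPhi r (∏ k, (∑ i, C (a k i) * X i + h k)) = ∏ k, (1 - soloBlindOBT r (a k)) := by
    rw [map_prod]
    exact Finset.prod_congr rfl fun k _ => by rw [← hp k, soloBlindOH_Phi_p]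
  have htop : (∏ k, (∑ i, C (a k i) * X i + h k) : MvPolynomial (Fin r) (ZMod 3)).coeff
      (soloBlindOHTop r) = 1 := by
    rw [← soloBlindOH_coeff_Phi, hP, soloBlindOB_coeff, soloBlindOB_signedCount_eq_one a hz hm]
  have hdeg : (soloBlindOHTop r).degree = 2 * r := by
    simp [soloBlindOHTop, Finsupp.degree_eq_sum, mul_comm]
  rw [hprod, coeff_add, hR _ (by rw [hdeg, Finset.card_univ, Fintype.card_fin]; omega), add_zero] at htop
  exact htop

/-- THEOREM (c806).  A zero-sum-free sequence of the maximal length `2r` in `𝔽₃^r` misses a linear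
hyperplane: some linear functional `y` has `⟨a_k, y⟩ ≠ 0` for every `k`. -/
theorem soloBlindOH_misses_hyperplane {m : ℕ} (hm : m = 2 * r) (a : Fin m → Fin r → ZMod 3)
    (hz : ∀ T : Finset (Fin m), T.Nonempty → ∑ k ∈ T, a k ≠ 0) :
    ∃ y : Fin r → ZMod 3, ∀ k, ∑ i, a k i * y i ≠ 0 := by
  classical
  set L : MvPolynomial (Fin r) (ZMod 3) := ∏ k, ∑ i, C (a k i) * X i with hL
  have hcoeff : L.coeff (soloBlindOHTop r) ≠ 0 := by
    rw [hL, soloBlindOH_coeff_top_linear hm a hz]; decide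
  have hdeg : (soloBlindOHTop r).degree = 2 * r := by
    simp [soloBlindOHTop, Finsupp.degree_eq_sum, mul_comm]
  have htot : L.totalDegree = (soloBlindOHTop r).degree := by
    apply le_antisymm
    · rw [hdeg, hL]
      refine (totalDegree_finsetProd _ _).trans ?_
      have : ∀ k : Fin m, (∑ i, C (a k i) * X i : MvPolynomial (Fin r) (ZMod 3)).totalDegree ≤ 1 :=
        fun k => totalDegree_finsetSum_le fun i _ =>
          (totalDegree_mul _ _).trans (by rw [totalDegree_C, totalDegree_X, zero_add])
      refine (Finset.sum_le_sum fun k _ => this k).trans ?_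
      simp [hm]
    · exact le_totalDegree (mem_support_iff.mpr hcoeff)
  obtain ⟨y, -, hy⟩ := combinatorial_nullstellensatz_exists_eval_nonzero L (soloBlindOHTop r) hcoeff
    htot (fun _ => Finset.univ) fun i => by
      simp [soloBlindOHTop, ZMod.card]
  refine ⟨y, fun k => ?_⟩
  have hy' : ∏ k, (∑ i, a k i * y i) ≠ 0 := by
    have : eval y L = ∏ k, ∑ i, a k i * y i := by
      rw [hL, eval_prod]
      simp [eval_C, eval_X]
    rwa [this] at hy
  exact (Finset.prod_ne_zero_iff.mp hy') k (mem_univ k)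

end OlsonHyperplane

end Summit.MatrixMultiplication.MatrixMultiplication.Theorems
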